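/-
Copyright (c) 2026 the pub-hodgecm-mathlib formalisation cell (harness21).  Prover seat hodgecm-mathlib-K2E3-p37 (g4), Track B «K2-LIT» ∕ hLiu418
#184♮, Road I v3, unit U5 «THE CLOSE», FACE-D₀ rows `hfin₂`, route (B3) «GLOBAL UNFOLDING», file B3-2a: FUBINI OVER THE THETA QUOTIENT — the `S`-th Fourier
coefficient of the doubled line theta lift is the `μW`-integral of the `S`-th Fourier coefficients of the KERNEL SLICES (LEAD F0P6-plan (g16) BATCH #274 (1),
K2 bus 2026-09-05T03:18Z cut).  THEOREMS ONLY.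
-/
import Summits.HodgeConjecture.HodgeConjecture.Theorems.K2LiuFirstTermLineLiftRankRow        -- ★ (B4): `fourierCoeffDelta_thetaLift_eq_at_one` (+ ★ D8, ★ (D)∕(A1)∕(A2), ★ p862640, ★ slice integrals)
import Summits.HodgeConjecture.HodgeConjecture.Theorems.K2LiuSiegelUnipotentHaarPinned       -- ★ `locallyCompactSpace_unipDelta`, `secondCountableTopology_unipDelta`
import Mathlib.MeasureTheory.Integral.Prod
import HarnessLib

/-!
# K2_Liu road (hLiu418 = stmt-HodgeConjecture-24832), U5 «THE CLOSE», FACE-D₀ row `hfin₂`, route (B3) file B3-2a: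
# `cf_S(Θ̃_Φ(fw))(1) = ∫_{[U(⟨a′⟩)]} fw(q) · cf_S(θ_Φ(·, q))(1) dμW(q)` — FUBINI OVER THE THETA QUOTIENT

Cell `pub/hodgecm-mathlib` (D-0151), Track B, build stream 29; helper lane `--supports stmt-HodgeConjecture-24832 --as helper`, count-neutral; closes no socket.
THEOREMS ONLY (no `def`, no `instance`, no notation, no named-fact hypothesis, no `sorry`).

THE PLACE IN THE CHAIN.  Route (B3) pays the theta-side rank-one letters `hloc₂′ ∧ hsign₂′` of ★ `K2LiuRigidityRowsOfRecord(NegKeyed)` through ONE global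
statement «a surviving rank-one index of the theta side is a GLOBAL Gram of the line `⟨a′⟩`» (★ `K2LiuRankOneLettersOfGlobalGram`, the consumer), obtained by
UNFOLDING the Fourier coefficient `cf_S(Θ̃_Φ(fw))` along `N_Δ(L⁺)∖N_Δ(𝔸)` of the doubled line theta lift ★ D8 `doubledLineThetaLift`
(`Θ̃_Φ(fw)(h) = ∫ q, fw q · θ_Φ((toDiagA h)⁻¹Γ, q) dμW`, `θ_Φ` the kernel ★ `ThetaKernelDatum.thetaKer` of ★ `lineThetaKernelDatum`).  The unfolding has three
independent steps; THIS FILE is the first, which needs NO model of the Weil representation: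
* §1 **`cf_thetaLift_eq_integral_cf_kernel`** — for every `S`, `Φ`: `cf_S(Θ̃_Φ(fw))(1) = ∫ q, fw q · cf_S(h ↦ θ_Φ((toDiagA h)⁻¹Γ, q))(1) dμW(q)`
  (★ (D) `fourierCoeffDelta_def`: `cf_S(φ)(1) = (∫⁻ βw)⁻¹ • ∫ βw(u) • (conj ψ_S(u) · φ(u · 1)) dνN`; Fubini on `N_Δ(𝔸) × [U(⟨a′⟩)]` — the integrand is
  `βw(u) ×` a CONTINUOUS function of `(u, q)` (★ `ThetaKernelDatum.continuous_thetaKer`), `βw` has finite mass and lives on the compact `K` (`hβK`), the theta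
  quotient is compact (★ `compactSpace_quotient_range_toAdelic_JW`) and `μW` is finite; `N_Δ(𝔸)` is second countable and locally compact (★), so the product
  σ-algebra sees the open sets and the Haar measure `νN` is σ-finite);
* §1 `integrable_wt_smul_kernel_prod` — the integrability on `νN.prod μW` behind it (stated once, reusable by B3-2b);
* §2 **`exists_cf_kernel_ne_zero_of_cf_thetaLift_ne_zero`** — the support corollary at `1` and, through ★ (B4) `fourierCoeffDelta_thetaLift_eq_at_one`, AT EVERY `h`
  (`…_at`): a non-zero `cf_S(Θ̃_Φ(fw))(h)` forces a non-zero kernel-slice coefficient `cf_S(θ_{ω(toDiagA h,1)Φ}(·, q))(1)` at some `q`.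
NEXT (other files): B3-2b unfolds the kernel slice `h ↦ θ_Ψ((toDiagA h)⁻¹Γ, q) = Θ_𝔸(ω(toDiagA h, y_q⁻¹)Ψ)` against `N_Δ(𝔸)` in a Θ-fixing κ-model (★ p863642
`omega_eq_conj_siegelLift_of_mem_unipDelta`, ★ `coe_toOp_adelicSiegelLift`, B3-1 orthogonality) into a lattice sum over the indices `ξ` with `Q ξ = S`; B3-3
(FACE-D₀ desk) reads `Q ξ = dict′(b • ū ⊗ u)` as a global Gram.
HONEST LABEL: HC_CM is proved only modulo the 7 printed citations (2 remaining named inputs: hLiu418 = stmt-HodgeConjecture-24832, h413 = stmt-HodgeConjecture-24833)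
until rung 0 closes; this file moves no counter.

References: [Weil1964] A. Weil, Acta Math. 111 (1964), Chap. III n° 41 Thm 6 p. 193; [KudlaRallis1994] S. Kudla, S. Rallis, Ann. of Math. 140 (1994) §3 (Fourier
coefficients of theta integrals); [Rallis1984] S. Rallis, Compositio Math. 51 (1984) §4; [MoeglinWaldspurger1995] C. Mœglin, J.-L. Waldspurger, CUP (1995) I.2.6;
[FleigEtAl2018] P. Fleig et al., CUP (2018) §12.3 (12.37); [Liu2021] Y. Liu, Camb. J. Math. 9 (2021) App. B (B.7), Prop. B.8 p. 104.
-/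

set_option autoImplicit false
set_option linter.dupNamespace false
-- statements over the adelic dual-pair carriers elaborate to very large types; elaborate sequentially (as in ★ `K2LiuFirstTermLineLiftRankRow`)
set_option Elab.async false

noncomputable section

open NumberField MeasureTheory IsDedekindDomain Function
open scoped Matrix ComplexOrder ENNReal ComplexConjugate

namespace Summit.HodgeConjecture.HodgeConjecture.Cruxes.HLiu418.K2LiuDoubledLineThetaCoeffFubini

open Literature.NumberTheory.Automorphic Literature.NumberTheory.Automorphic.UnitaryGroup
open Literature.NumberTheory.Automorphic.IdeleClassGroup
open Literature.NumberTheory.Automorphic.Liu2021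
open Literature.NumberTheory.Automorphic.Liu2021.Def411WeilCarriers
open Literature.NumberTheory.Automorphic.Liu2021.Def411WeilCarriersDoubling
open Literature.NumberTheory.GelbartRogawski1991 Literature.NumberTheory.GelbartRogawski1991.UnitaryDualPair
open Literature.NumberTheory.GelbartRogawski1991.GRConstruction
open Literature.NumberTheory.GaloisRepresentations
open Literature.NumberTheory.Weil1964
open Literature.RepresentationTheory.Liu2021
open Literature.NumberTheory.K2Lit.DoubledLineTheta Literature.NumberTheory.K2Lit.SiegelDoubled
open Literature.MeasureTheory.Group
open Summit.HodgeConjecture.HodgeConjecture.Cruxes.HLiu418.K2LiuSiegelUnipotentFourierDefs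
open Summit.HodgeConjecture.HodgeConjecture.Cruxes.HLiu418.K2LiuSiegelUnipotentCharacters
open Summit.HodgeConjecture.HodgeConjecture.Cruxes.HLiu418.K2LiuUnipotentCoveringWeight
open Summit.HodgeConjecture.HodgeConjecture.Cruxes.HLiu418.K2LiuFirstTermLineLiftRankRow (fourierCoeffDelta_thetaLift_eq_at_one)
open Summit.HodgeConjecture.HodgeConjecture.Cruxes.HLiu418.K2LiuSiegelUnipotentHaarPinned (locallyCompactSpace_unipDelta secondCountableTopology_unipDelta)

variable (L : Type) [Field L] [NumberField L] [IsCMField L]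
variable {N n : ℕ} (e : Fin N × Fin 1 ≃ Fin n)
  (dV : Fin N → L) (hdV : ∀ i, IsCMField.complexConj L (dV i) = dV i)
  (dW : Fin 1 → L) (hdW : ∀ i, IsCMField.complexConj L (dW i) = dW i)
  {n'' : ℕ} (e₁ : Fin (n + n) × Fin 1 ≃ Fin n'')
  (hdV0 : ∀ i, dV i ≠ 0) (hdW0 : ∀ i, dW i ≠ 0)
  (lam : IdeleClassGroup L →ₜ* Circle) (hlam : IsConjugateSymplectic L lam) (a' : (Fp L)ˣ)
  (hρ : HasThetaMajorants fun
      (p : ↥(UnitaryGroup.adelic (Fp L) L (IsCMField.complexConj L) (n + n) (Matrix.diagonal (dD L e dV hdV dW hdW))) ×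
        ↥(UnitaryGroup.adelic (Fp L) L (IsCMField.complexConj L) 1 (JW (Fp L) L a')))
      (Φ : piSchwartzBruhat (Fp L) (Fin n'')) =>
        pairRep (Fp L) L (IsCMField.complexConj L) (n + n) 1 e₁ (Matrix.diagonal (dD L e dV hdV dW hdW)) (JW (Fp L) L a')
          (chiSplittingLine L e₁ (dD L e dV hdV dW hdW) (dD_conj L e dV hdV dW hdW) (dD_ne_zero L e dV hdV dW hdW hdV0 hdW0)
            (toHeckeCharacter L lam) (isUnitary_toHeckeCharacter L lam)
            ((isOscillatorChar_toHeckeCharacter_iff lam).mpr hlam) (TW (Fp L) a')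
            (isUnit_det_TW (Fp L) a') (JW (Fp L) L a') (JW_eq (Fp L) L a'))
          p Φ)
  [MeasurableSpace (↥(UnitaryGroup.adelic (Fp L) L (IsCMField.complexConj L) 1 (JW (Fp L) L a')) ⧸
    (UnitaryGroup.toAdelic (Fp L) L (IsCMField.complexConj L) 1 (JW (Fp L) L a')).range)]
  [BorelSpace (↥(UnitaryGroup.adelic (Fp L) L (IsCMField.complexConj L) 1 (JW (Fp L) L a')) ⧸
    (UnitaryGroup.toAdelic (Fp L) L (IsCMField.complexConj L) 1 (JW (Fp L) L a')).range)]
  (μW : Measure (↥(UnitaryGroup.adelic (Fp L) L (IsCMField.complexConj L) 1 (JW (Fp L) L a')) ⧸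
    (UnitaryGroup.toAdelic (Fp L) L (IsCMField.complexConj L) 1 (JW (Fp L) L a')).range)) [IsFiniteMeasure μW]
  (fw : C(↥(UnitaryGroup.adelic (Fp L) L (IsCMField.complexConj L) 1 (JW (Fp L) L a')) ⧸
    (UnitaryGroup.toAdelic (Fp L) L (IsCMField.complexConj L) 1 (JW (Fp L) L a')).range, ℂ))
  [MeasurableSpace (unipDelta L e dV hdV dW hdW)] [BorelSpace (unipDelta L e dV hdV dW hdW)]
  (νN : Measure (unipDelta L e dV hdV dW hdW)) [νN.IsHaarMeasure]
  {βw : unipDelta L e dV hdV dW hdW → ℝ≥0∞} (hβ : IsCoveringWeight (unipDeltaRat L e dV hdV dW hdW) βw) (hβtop : ∫⁻ u, βw u ∂νN ≠ ∞)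
  {K : Set (unipDelta L e dV hdV dW hdW)} (hK : IsCompact K) (hβK : ∀ u, βw u ≤ K.indicator 1 u)
  (S : Matrix (Fin n) (Fin n) L)

/-! ## §1 Fubini over the theta quotient -/

include hβ hβtop hK hβK

omit [νN.IsHaarMeasure] in
set_option maxHeartbeats 1000000 in -- the theta-kernel datum's statement telescope (as ★ (B4) `fourierCoeffDelta_thetaLift_eq_at_one`)
/-- **INTEGRABILITY ON `N_Δ(𝔸) × [U(⟨a′⟩)]`** of `(u, q) ↦ βw(u) • (conj ψ_S(u) · (fw(q) · θ_Φ((toDiagA (u·1))⁻¹Γ, q)))`: the second factor is continuous in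
`(u, q)` (★ `continuous_thetaKer`, ★ `continuous_unipDeltaChar_coe`, `fw` continuous) hence bounded on `K × [U(⟨a′⟩)]` (compact), and `βw` vanishes off `K`
(`hβK`) with `∫⁻ βw < ∞`. [cite: Weil1964, Chap. III n° 41 Thm 6 p. 193] [cite: MoeglinWaldspurger1995, I.2.6] -/
theorem integrable_wt_smul_kernel_prod (Φ : piSchwartzBruhat (Fp L) (Fin n'')) :
    Integrable (uncurry fun (u : unipDelta L e dV hdV dW hdW)
        (q : ↥(UnitaryGroup.adelic (Fp L) L (IsCMField.complexConj L) 1 (JW (Fp L) L a')) ⧸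
          (UnitaryGroup.toAdelic (Fp L) L (IsCMField.complexConj L) 1 (JW (Fp L) L a')).range) =>
      (βw u).toReal • (conj (unipDeltaChar L e dV hdV dW hdW S (u : HA L e dV hdV dW hdW) : ℂ) *
        (fw q * (lineThetaKernelDatum L (n + n) e₁ (dD L e dV hdV dW hdW) (dD_conj L e dV hdV dW hdW)
            (dD_ne_zero L e dV hdV dW hdW hdV0 hdW0) lam hlam a' hρ).thetaKer Φ
          (QuotientGroup.mk (toDiagA L e dV hdV dW hdW ((u : HA L e dV hdV dW hdW) * 1))⁻¹, q))))
      (νN.prod μW) := by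
  haveI := compactSpace_quotient_range_toAdelic_JW L a'
  haveI : SecondCountableTopology (unipDelta L e dV hdV dW hdW) := secondCountableTopology_unipDelta L e dV hdV dW hdW
  haveI : LocallyCompactSpace (unipDelta L e dV hdV dW hdW) := locallyCompactSpace_unipDelta L e dV hdV dW hdW
  -- the continuous factor
  set M := lineThetaKernelDatum L (n + n) e₁ (dD L e dV hdV dW hdW) (dD_conj L e dV hdV dW hdW)
    (dD_ne_zero L e dV hdV dW hdW hdV0 hdW0) lam hlam a' hρ with hM
  have hP : Continuous fun u : unipDelta L e dV hdV dW hdW =>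
      (QuotientGroup.mk (toDiagA L e dV hdV dW hdW ((u : HA L e dV hdV dW hdW) * 1))⁻¹ :
        ↥(UnitaryGroup.adelic (Fp L) L (IsCMField.complexConj L) (n + n) (Matrix.diagonal (dD L e dV hdV dW hdW))) ⧸
          (UnitaryGroup.toAdelic (Fp L) L (IsCMField.complexConj L) (n + n) (Matrix.diagonal (dD L e dV hdV dW hdW))).range) :=
    continuous_quotient_mk'.comp ((continuous_toDiagA L e dV hdV dW hdW).comp (continuous_subtype_val.mul continuous_const)).inv
  have hH : Continuous fun p : unipDelta L e dV hdV dW hdW ×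
      (↥(UnitaryGroup.adelic (Fp L) L (IsCMField.complexConj L) 1 (JW (Fp L) L a')) ⧸
        (UnitaryGroup.toAdelic (Fp L) L (IsCMField.complexConj L) 1 (JW (Fp L) L a')).range) =>
      conj (unipDeltaChar L e dV hdV dW hdW S (p.1 : HA L e dV hdV dW hdW) : ℂ) *
        (fw p.2 * M.thetaKer Φ (QuotientGroup.mk (toDiagA L e dV hdV dW hdW ((p.1 : HA L e dV hdV dW hdW) * 1))⁻¹, p.2)) := by
    refine ((Complex.continuous_conj.comp (continuous_unipDeltaChar_coe L e dV hdV dW hdW S)).comp continuous_fst).mul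
      ((fw.continuous.comp continuous_snd).mul ?_)
    exact (M.thetaKer Φ).continuous.comp ((hP.comp continuous_fst).prodMk continuous_snd)
  -- a uniform bound of the continuous factor on `K × univ`
  obtain ⟨C, hC⟩ : ∃ C, ∀ p ∈ K ×ˢ (Set.univ : Set (↥(UnitaryGroup.adelic (Fp L) L (IsCMField.complexConj L) 1 (JW (Fp L) L a')) ⧸
        (UnitaryGroup.toAdelic (Fp L) L (IsCMField.complexConj L) 1 (JW (Fp L) L a')).range)),
      ‖conj (unipDeltaChar L e dV hdV dW hdW S (p.1 : HA L e dV hdV dW hdW) : ℂ) *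
        (fw p.2 * M.thetaKer Φ (QuotientGroup.mk (toDiagA L e dV hdV dW hdW ((p.1 : HA L e dV hdV dW hdW) * 1))⁻¹, p.2))‖ ≤ C :=
    (hK.prod isCompact_univ).exists_bound_of_continuousOn hH.continuousOn
  -- off `K` the weight vanishes
  have hβ0 : ∀ u ∉ K, βw u = 0 := fun u hu => by
    have h := hβK u
    rw [Set.indicator_of_notMem hu] at h
    exact le_antisymm h bot_le
  -- integrability of the weight
  have hβint : Integrable (fun u : unipDelta L e dV hdV dW hdW => (βw u).toReal) νN :=
    integrable_toReal_of_lintegral_ne_top hβ.1.aemeasurable hβtop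
  refine Integrable.mono' (hβint.mul_prod (integrable_const (|C|))) ?_ (ae_of_all _ fun p => ?_)
  · exact ((hβ.1.comp measurable_fst).ennreal_toReal.aestronglyMeasurable).smul hH.stronglyMeasurable.aestronglyMeasurable
  · rcases p with ⟨u, q⟩
    simp only [uncurry_apply_pair, norm_smul, Real.norm_eq_abs, ENNReal.abs_toReal]
    by_cases hu : u ∈ K
    · exact mul_le_mul_of_nonneg_left ((hC (u, q) ⟨hu, Set.mem_univ _⟩).trans (le_abs_self C)) ENNReal.toReal_nonneg
    · rw [hβ0 u hu, ENNReal.toReal_zero, zero_mul, zero_mul]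

set_option maxHeartbeats 1000000 in -- idem
/-- **B3-2a — FUBINI OVER THE THETA QUOTIENT: `cf_S(Θ̃_Φ(fw))(1) = ∫ q, fw q · cf_S(θ_Φ((toDiagA ·)⁻¹Γ, q))(1) dμW(q)`.**  The `S`-th Fourier coefficient
along `N_Δ(L⁺)∖N_Δ(𝔸)` (★ (D) `fourierCoeffDelta`, covering-weight currency) of the doubled line theta lift ★ D8 `doubledLineThetaLift … Φ fw` at `1` is the
`μW`-integral, against the weight `fw`, of the `S`-th Fourier coefficients at `1` of the kernel slices `h ↦ θ_Φ((toDiagA h)⁻¹Γ, q)`.  No model of the Weil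
representation enters: ★ D8 `doubledLineThetaLift_apply`, ★ (D) `fourierCoeffDelta_def`, and Fubini (`integrable_wt_smul_kernel_prod`).
[cite: KudlaRallis1994, §3] [cite: Weil1964, Chap. III n° 41 Thm 6 p. 193] [cite: FleigEtAl2018, §12.3 (12.37)] [cite: MoeglinWaldspurger1995, I.2.6] -/
theorem cf_thetaLift_eq_integral_cf_kernel (Φ : piSchwartzBruhat (Fp L) (Fin n'')) :
    fourierCoeffDelta L e dV hdV dW hdW νN βw S (doubledLineThetaLift L e dV hdV dW hdW e₁ hdV0 hdW0 lam hlam a' hρ μW Φ fw) 1 =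
      ∫ q, fw q * fourierCoeffDelta L e dV hdV dW hdW νN βw S
        (fun h => (lineThetaKernelDatum L (n + n) e₁ (dD L e dV hdV dW hdW) (dD_conj L e dV hdV dW hdW)
            (dD_ne_zero L e dV hdV dW hdW hdV0 hdW0) lam hlam a' hρ).thetaKer Φ
          (QuotientGroup.mk (toDiagA L e dV hdV dW hdW h)⁻¹, q)) 1 ∂μW := by
  haveI := compactSpace_quotient_range_toAdelic_JW L a'
  haveI : SecondCountableTopology (unipDelta L e dV hdV dW hdW) := secondCountableTopology_unipDelta L e dV hdV dW hdW
  haveI : LocallyCompactSpace (unipDelta L e dV hdV dW hdW) := locallyCompactSpace_unipDelta L e dV hdV dW hdW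
  -- σ-finiteness of both measures, pinned by hand (instance search times out on the carriers)
  haveI : SigmaFinite μW := IsFiniteMeasure.toSigmaFinite μW
  haveI : SFinite μW := inferInstance
  haveI : SigmaCompactSpace (unipDelta L e dV hdV dW hdW) := sigmaCompactSpace_of_locallyCompact_secondCountable
  haveI : SigmaFinite νN := Measure.IsHaarMeasure.sigmaFinite νN
  haveI : SFinite νN := inferInstance
  set M := lineThetaKernelDatum L (n + n) e₁ (dD L e dV hdV dW hdW) (dD_conj L e dV hdV dW hdW)
    (dD_ne_zero L e dV hdV dW hdW hdV0 hdW0) lam hlam a' hρ with hM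
  have hG := integrable_wt_smul_kernel_prod L e dV hdV dW hdW e₁ hdV0 hdW0 lam hlam a' hρ μW fw νN hβ hβtop hK hβK S Φ
  rw [← hM] at hG
  -- both sides as iterated integrals of the same integrand
  simp only [fourierCoeffDelta_def, doubledLineThetaLift_apply]
  rw [← hM]
  -- LHS inner: push `βw(u) • (conj ψ_S(u) · _)` inside the `q`-integral
  have hL : ∀ u : unipDelta L e dV hdV dW hdW,
      (βw u).toReal • (conj (unipDeltaChar L e dV hdV dW hdW S (u : HA L e dV hdV dW hdW) : ℂ) *
          ∫ q, fw q * M.thetaKer Φ (QuotientGroup.mk (toDiagA L e dV hdV dW hdW ((u : HA L e dV hdV dW hdW) * 1))⁻¹, q) ∂μW) =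
        ∫ q, (βw u).toReal • (conj (unipDeltaChar L e dV hdV dW hdW S (u : HA L e dV hdV dW hdW) : ℂ) *
          (fw q * M.thetaKer Φ (QuotientGroup.mk (toDiagA L e dV hdV dW hdW ((u : HA L e dV hdV dW hdW) * 1))⁻¹, q))) ∂μW := fun u => by
    rw [integral_smul, integral_const_mul]
  -- RHS inner: pull `fw q` inside the `u`-integral and the normalising scalar outside
  have hR : ∀ q : ↥(UnitaryGroup.adelic (Fp L) L (IsCMField.complexConj L) 1 (JW (Fp L) L a')) ⧸
        (UnitaryGroup.toAdelic (Fp L) L (IsCMField.complexConj L) 1 (JW (Fp L) L a')).range,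
      fw q * (((∫⁻ u, βw u ∂νN).toReal⁻¹ : ℝ) •
          ∫ u, (βw u).toReal • (conj (unipDeltaChar L e dV hdV dW hdW S (u : HA L e dV hdV dW hdW) : ℂ) *
            M.thetaKer Φ (QuotientGroup.mk (toDiagA L e dV hdV dW hdW ((u : HA L e dV hdV dW hdW) * 1))⁻¹, q)) ∂νN) =
        ((∫⁻ u, βw u ∂νN).toReal⁻¹ : ℝ) •
          ∫ u, (βw u).toReal • (conj (unipDeltaChar L e dV hdV dW hdW S (u : HA L e dV hdV dW hdW) : ℂ) *
            (fw q * M.thetaKer Φ (QuotientGroup.mk (toDiagA L e dV hdV dW hdW ((u : HA L e dV hdV dW hdW) * 1))⁻¹, q))) ∂νN := fun q => by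
    rw [mul_smul_comm, ← integral_const_mul]
    congr 1
    refine integral_congr_ae (Filter.Eventually.of_forall fun u => ?_)
    beta_reduce
    rw [Complex.real_smul, Complex.real_smul]
    ring
  simp_rw [hL, hR]
  rw [integral_smul, integral_integral_swap hG]

/-! ## §2 The support corollaries -/

set_option maxHeartbeats 1000000 in -- idem
/-- **SUPPORT COROLLARY AT `1`**: if `cf_S(Θ̃_Φ(fw))(1) ≠ 0` then some kernel slice has a non-zero `S`-th coefficient: `∃ q, cf_S(θ_Φ((toDiagA ·)⁻¹Γ, q))(1) ≠ 0`
(the integrand of §1 cannot vanish identically). [cite: KudlaRallis1994, §3] [cite: Rallis1984, §4] -/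
theorem exists_cf_kernel_ne_zero_of_cf_thetaLift_ne_zero (Φ : piSchwartzBruhat (Fp L) (Fin n''))
    (hne : fourierCoeffDelta L e dV hdV dW hdW νN βw S (doubledLineThetaLift L e dV hdV dW hdW e₁ hdV0 hdW0 lam hlam a' hρ μW Φ fw) 1 ≠ 0) :
    ∃ q : ↥(UnitaryGroup.adelic (Fp L) L (IsCMField.complexConj L) 1 (JW (Fp L) L a')) ⧸
        (UnitaryGroup.toAdelic (Fp L) L (IsCMField.complexConj L) 1 (JW (Fp L) L a')).range,
      fourierCoeffDelta L e dV hdV dW hdW νN βw S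
        (fun h => (lineThetaKernelDatum L (n + n) e₁ (dD L e dV hdV dW hdW) (dD_conj L e dV hdV dW hdW)
            (dD_ne_zero L e dV hdV dW hdW hdV0 hdW0) lam hlam a' hρ).thetaKer Φ
          (QuotientGroup.mk (toDiagA L e dV hdV dW hdW h)⁻¹, q)) 1 ≠ 0 := by
  by_contra hall
  push Not at hall
  apply hne
  rw [cf_thetaLift_eq_integral_cf_kernel L e dV hdV dW hdW e₁ hdV0 hdW0 lam hlam a' hρ μW fw νN hβ hβtop hK hβK S Φ]
  simp only [hall, mul_zero, integral_zero]

set_option maxHeartbeats 1000000 in -- idem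
/-- **SUPPORT COROLLARY AT `h`**: if `cf_S(Θ̃_Φ(fw))(h) ≠ 0` then, for the Weil translate `Φ_h := ω(toDiagA h, 1)Φ` (★ (B4) `fourierCoeffDelta_thetaLift_eq_at_one`),
some kernel slice `θ_{Φ_h}((toDiagA ·)⁻¹Γ, q)` has a non-zero `S`-th coefficient at `1`.  This is the shape B3-2b ∕ B3-3 consume.
[cite: KudlaRallis1994, §3] [cite: Weil1964, Chap. III n° 41 Thm 6 p. 193] -/
theorem exists_cf_kernel_ne_zero_of_cf_thetaLift_ne_zero_at (Φ : piSchwartzBruhat (Fp L) (Fin n'')) (h : HA L e dV hdV dW hdW)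
    (hne : fourierCoeffDelta L e dV hdV dW hdW νN βw S (doubledLineThetaLift L e dV hdV dW hdW e₁ hdV0 hdW0 lam hlam a' hρ μW Φ fw) h ≠ 0) :
    ∃ q : ↥(UnitaryGroup.adelic (Fp L) L (IsCMField.complexConj L) 1 (JW (Fp L) L a')) ⧸
        (UnitaryGroup.toAdelic (Fp L) L (IsCMField.complexConj L) 1 (JW (Fp L) L a')).range,
      fourierCoeffDelta L e dV hdV dW hdW νN βw S
        (fun h' => (lineThetaKernelDatum L (n + n) e₁ (dD L e dV hdV dW hdW) (dD_conj L e dV hdV dW hdW)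
            (dD_ne_zero L e dV hdV dW hdW hdV0 hdW0) lam hlam a' hρ).thetaKer
          (pairRep (Fp L) L (IsCMField.complexConj L) (n + n) 1 e₁ (Matrix.diagonal (dD L e dV hdV dW hdW)) (JW (Fp L) L a')
            (chiSplittingLine L e₁ (dD L e dV hdV dW hdW) (dD_conj L e dV hdV dW hdW) (dD_ne_zero L e dV hdV dW hdW hdV0 hdW0)
              (toHeckeCharacter L lam) (isUnitary_toHeckeCharacter L lam)
              ((isOscillatorChar_toHeckeCharacter_iff lam).mpr hlam) (TW (Fp L) a')
              (isUnit_det_TW (Fp L) a') (JW (Fp L) L a') (JW_eq (Fp L) L a'))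
            (toDiagA L e dV hdV dW hdW h, 1) Φ)
          (QuotientGroup.mk (toDiagA L e dV hdV dW hdW h')⁻¹, q)) 1 ≠ 0 := by
  rw [fourierCoeffDelta_thetaLift_eq_at_one] at hne
  exact exists_cf_kernel_ne_zero_of_cf_thetaLift_ne_zero L e dV hdV dW hdW e₁ hdV0 hdW0 lam hlam a' hρ μW fw νN hβ hβtop hK hβK S _ hne

end Summit.HodgeConjecture.HodgeConjecture.Cruxes.HLiu418.K2LiuDoubledLineThetaCoeffFubini

end
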